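import Summits.RiemannHypothesis.RiemannHypothesis.Theorems.WeilFormatCDataO1035FrontData
import Summits.RiemannHypothesis.RiemannHypothesis.Theorems.S2FormatCE0
import Literature.NumberTheory.LFunctions.YoshidaWindowGramTailMSSines
import Literature.NumberTheory.LFunctions.YoshidaWindowGramMiddleJBox
import Literature.NumberTheory.LFunctions.YoshidaWindowGramTailJFactoredScaled
import Literature.NumberTheory.LFunctions.YoshidaWindowGramTailMSFactored
import Literature.NumberTheory.LFunctions.YoshidaWindowGramTailJDiagTight
import Summits.RiemannHypothesis.RiemannHypothesis.Theorems.FormatCPsdBands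
import Summits.RiemannHypothesis.RiemannHypothesis.Theorems.WeilFormatCDiagShift
import Summits.RiemannHypothesis.RiemannHypothesis.Theorems.FormatCPsdSymmBands
import HarnessLib

/-!
# Format C kernel rung `O1035` (a = 207/200, column-band layout): odd sector: certified digits of the scaled mean-square order-J tail factors φ/B^p, ψ·B^p (+ compressed middle) (kernel certificates) — PART 4/4 (tPsi224, tRDf; the one-file tail module exceeds the gate's 600-s cap at hp, prover B g21 split)

Window `a = 207/200`; prime powers in the window: 2, 3, 2^2, 5, 7; prime constant A = 2148/1000 (`WeilFormatC.primeCoeff_form_ge_cells_v2`); evaluator parameters S = 2^320, Kpi 160, Kser 190, kred 8, Kexp 55, J 150; full table modes < 257; light column table modes < 2051; units 2^-310 (Schur entries), 2^-154 (column digits, width 157), 2^-148 (tail-factor digits, width 151), 2^-64 (reciprocal weights), 2^-40 (tail base); order-J tail J = 4, θ = 1/2048, η = 1/10 | 4/1.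
Design row: sr-gb-rung-b B g21 hp odd λ-run (parity cell 14 L-side): a = 207/200, A = 2148/1000 (cells_v2), μ = 2^-97, odd 256/512/2048, kit precision S 2^320 / c 310 / Kpi 160 / Kser 190 / Kexp 55 / J 150 (A g23 hp levers), MS tail; see HOME(B)/CELL14-LSIDE-B-g21.md. Generated by sr-gb-rung-a prover A g22 with rh-explicit-weil-2 gen7's generator extended for the odd λ-run (--sector odd --mu-log2; HOME(A)/code-g22/gen7/gramgen7.py sha16 b21c14hp10350001) from `#eval` of the tree's `Encl` functions; every datum is re-verified by the kernel in the theorem files (`decide +kernel`). Helper data of the rh-explicit Weil-positivity programme (format C, K-CELL-2), RH-free. [cite: Yoshida1992HermitianForms, §5 (5.15)-(5.16) p. 301; §7 pp. 305–312]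
-/

set_option linter.dupNamespace false
set_option exponentiation.threshold 1024
set_option maxRecDepth 200000

namespace Summit.RiemannHypothesis.RiemannHypothesis.Theorems.WeilFormatCData.O1035CBOdd
open Literature.NumberTheory.LFunctions Literature.NumberTheory.LFunctions.Yoshida1992 Encl Literature.Analysis.ValidatedNumerics.NumericsMP
open Summit.RiemannHypothesis.RiemannHypothesis.Theorems.WeilFormatCData.O1035

/-- kernel: ψ-digits rows `[224, 256)`. -/
theorem tPsi224 : checkRect (2 ^ 320) 148 (O1035CBOdd.ρψ : ℤ) 151 8 (2 ^ (151 - 1)) (fun i r ↦ (psiMidOSBox (2 ^ 320) O1035.C O1035.F (tget O1035.tab (i + 1)) 1 1024 256 4 O1035.momO i r).add (psiMSoSBox (2 ^ 320) O1035.C O1035.F O1035.ks (tget O1035.tab (i + 1)) 40 1719208028832 256 2048 4 1 2048 4 1 O1035.csd O1035.sd1 O1035.sdm O1035.sdp i r)) O1035CBOdd.ΨP 224 32 0 8 = true := by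
  decide +kernel

/-- kernel: digit sums of the factor rows. -/
theorem tRDf : checkRowDots 151 8 O1035CBOdd.ΦP (List.replicate 8 1) O1035CBOdd.Pφ 0 256 = true ∧ checkRowDots 151 8 O1035CBOdd.ΨP (List.replicate 8 1) O1035CBOdd.Pψ 0 256 = true := by
  constructor <;> decide +kernel

end Summit.RiemannHypothesis.RiemannHypothesis.Theorems.WeilFormatCData.O1035CBOdd
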